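import Mathlib
import Summits.Ventures.PercRepro2.HCov
import Summits.Ventures.PercRepro2.BasePendant
import Summits.Ventures.PercRepro2.PendantRoot
import Summits.Ventures.PercRepro2.RootLeafA3Events
import Summits.Ventures.PercRepro2.RootLeafA3
import Summits.Ventures.PercRepro2.RootLeafOEvents

/-!
# A ROOT as a leaf at an UNMARKED vertex `u`, part 2: the two worlds of the leaf edge
(blind cell PercRepro2, p4 g3; S3 (G4-u), proofs/subclaims/S3-CLASSES.md §S3.10)

The root `a₁` is a LEAF attached to the UNMARKED vertex `u` by the single edge `f` (`q = p f`);
the marks `o, a₂, a₃ = c, b` are distinct from `a₁`.  On `{f closed}` the root is isolated (the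
(ONE-ROOT) world: `Q` sure, `C₁ = {a₁}`, every mass a probability of an event of `C(a₂)` alone);
on `{f open}` the root is `u` (the instance `a₁ := u` on `G − a₁`).  Every one of the twelve masses
of `Gc` is the `q`-mixture of its two world values — the generic two-world lemmas of
`RootLeafA3Events` / `RootLeafA3` (the `Q`-masses and the connection masses) and of
`RootLeafOEvents` (the `PD` / `T` / `T′` masses), all parametric in the attachment vertex.
-/

namespace Summit.Ventures.PercRepro2

open UnionCluster CovForm PendantRoot

namespace RootLeafU

variable {V : Type*} {E : Type*} [Fintype E] [DecidableEq E] {R : Type*} [Field R]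
  [LinearOrder R] [IsStrictOrderedRing R]

section Splits

variable (p : E → R) {ends : E → Sym2 V} {f : E} {a₁ u : V} (hf : ends f = s(a₁, u))
  (hleaf : ∀ e, a₁ ∈ ends e → e = f) (h1u : a₁ ≠ u) {o a₂ c b : V} (h12 : a₁ ≠ a₂)
  (h1c : a₁ ≠ c) (h1o : a₁ ≠ o) (h1b : a₁ ≠ b)

include hf hleaf h1u h12

omit [LinearOrder R] [IsStrictOrderedRing R] in
/-- `P(Q) = q·P(Q¹) + (1 − q)·P(Ω)`. -/
lemma split_PQ : prob p (avoidAll ends a₂ {a₁}) =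
    p f * prob p (avoidAll ends a₂ {u}) + (1 - p f) * prob p Set.univ :=
  RootLeafA3.prob_Q p hf hleaf h1u h12

omit [LinearOrder R] [IsStrictOrderedRing R] h12 in
include h1b in
/-- `gap = q·gap¹ + (1 − q)·P(a₂ ↔ b)`. -/
lemma split_gap : gap p ends a₁ a₂ b =
    p f * gap p ends u a₂ b + (1 - p f) * prob p (connEvent ends a₂ b) := by
  unfold gap
  rw [RootLeafA3.prob_conn_leaf p hf hleaf h1u (Ne.symm h1b)]
  ring

omit [LinearOrder R] [IsStrictOrderedRing R] in
include h1o h1b in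
/-- `EQbo = q·EQbo¹ + (1 − q)·P(a₂ ↔ o, a₂ ↔ b)`. -/
lemma split_EQbo : EQbo p ends o a₁ a₂ b =
    p f * EQbo p ends o u a₂ b + (1 - p f) * prob p (connEvent ends a₂ o ∩ connEvent ends a₂ b) := by
  have fo : Free f (connEvent ends a₂ o) := free_connEvent hf hleaf h1u (Ne.symm h12) (Ne.symm h1o)
  have fb : Free f (connEvent ends a₂ b) := free_connEvent hf hleaf h1u (Ne.symm h12) (Ne.symm h1b)
  have e1 := RootLeafA3.prob_Q_inter_LL p hf hleaf h1u h12 (Ne.symm h1o) (Ne.symm h1b)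
  have e2 := RootLeafA3.prob_Q_inter p hf hleaf h1u h12 (fo.inter fb)
  have e3 := RootLeafA3.prob_Q_inter_R p hf hleaf h1u h12 (Ne.symm h1b) fo
  have e4 := RootLeafA3.prob_Q_inter_L p hf hleaf h1u h12 (Ne.symm h1o) fb
  unfold EQbo
  rw [e1, e2, e3, e4]
  ring

omit [LinearOrder R] [IsStrictOrderedRing R] in
include h1o in
/-- `EQo = q·EQo¹ − (1 − q)·P(a₂ ↔ o)`. -/
lemma split_EQo : EQo p ends o a₁ a₂ =
    p f * EQo p ends o u a₂ - (1 - p f) * prob p (connEvent ends a₂ o) := by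
  have fo : Free f (connEvent ends a₂ o) := free_connEvent hf hleaf h1u (Ne.symm h12) (Ne.symm h1o)
  have e1 := RootLeafA3.prob_Q_inter_L₀ p hf hleaf h1u h12 (Ne.symm h1o)
  have e2 := RootLeafA3.prob_Q_inter p hf hleaf h1u h12 fo
  unfold EQo
  rw [e1, e2]
  ring

include h1c

omit [LinearOrder R] [IsStrictOrderedRing R] in
/-- `D = q·D¹ + (1 − q)·P(a₂ ↮ c)`. -/
lemma split_D : prob p (PDEvent ends a₁ a₂ c) =
    p f * prob p (PDEvent ends u a₂ c) + (1 - p f) * prob p (avoidAll ends a₂ {c}) :=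
  RootLeafO.prob_PD p hf hleaf h1u h12 h1c

omit [LinearOrder R] [IsStrictOrderedRing R] in
include h1o in
/-- `Do = q·Do¹ + (1 − q)·P(a₂ ↮ c, a₂ ↔ o)`. -/
lemma split_Do : Do p ends o a₁ a₂ c =
    p f * Do p ends o u a₂ c + (1 - p f) * prob p (avoidAll ends a₂ {c} ∩ connEvent ends a₂ o) := by
  have fo : Free f (connEvent ends a₂ o) := free_connEvent hf hleaf h1u (Ne.symm h12) (Ne.symm h1o)
  have e1 := RootLeafO.prob_PD_inter_L₀ p hf hleaf h1u h12 h1c (Ne.symm h1o)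
  have e2 := RootLeafO.prob_PD_inter p hf hleaf h1u h12 h1c fo
  unfold Do
  rw [e1, e2]
  ring

omit [LinearOrder R] [IsStrictOrderedRing R] in
include h1b in
/-- `PDb = q·PDb¹ + (1 − q)·P(a₂ ↮ c, a₂ ↔ b)`. -/
lemma split_PDb : PDb p ends a₁ a₂ c b =
    p f * PDb p ends u a₂ c b + (1 - p f) * prob p (avoidAll ends a₂ {c} ∩ connEvent ends a₂ b) := by
  have fb : Free f (connEvent ends a₂ b) := free_connEvent hf hleaf h1u (Ne.symm h12) (Ne.symm h1b)
  have e1 := RootLeafO.prob_PD_inter_L₀ p hf hleaf h1u h12 h1c (Ne.symm h1b)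
  have e2 := RootLeafO.prob_PD_inter p hf hleaf h1u h12 h1c fb
  unfold PDb
  rw [e1, e2]
  ring

omit [LinearOrder R] [IsStrictOrderedRing R] in
include h1o h1b in
/-- `PDbo = q·PDbo¹ + (1 − q)·P(a₂ ↮ c, a₂ ↔ o, a₂ ↔ b)`. -/
lemma split_PDbo : PDbo p ends o a₁ a₂ c b =
    p f * PDbo p ends o u a₂ c b +
      (1 - p f) * prob p (avoidAll ends a₂ {c} ∩ (connEvent ends a₂ o ∩ connEvent ends a₂ b)) := by
  have fo : Free f (connEvent ends a₂ o) := free_connEvent hf hleaf h1u (Ne.symm h12) (Ne.symm h1o)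
  have fb : Free f (connEvent ends a₂ b) := free_connEvent hf hleaf h1u (Ne.symm h12) (Ne.symm h1b)
  have e1 := RootLeafO.prob_PD_inter_LL p hf hleaf h1u h12 h1c (Ne.symm h1o) (Ne.symm h1b)
  have e2 := RootLeafO.prob_PD_inter_R p hf hleaf h1u h12 h1c (Ne.symm h1b) fo
  have e3 := RootLeafO.prob_PD_inter_L p hf hleaf h1u h12 h1c (Ne.symm h1o) fb
  have e4 := RootLeafO.prob_PD_inter p hf hleaf h1u h12 h1c (fo.inter fb)
  unfold PDbo
  rw [e1, e2, e3, e4]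
  ring

omit [LinearOrder R] [IsStrictOrderedRing R] in
/-- `EQ3 = q·EQ3¹ − (1 − q)·P(a₂ ↔ c)`. -/
lemma split_EQ3 : EQ3 p ends a₁ a₂ c =
    p f * EQ3 p ends u a₂ c - (1 - p f) * prob p (connEvent ends a₂ c) := by
  have e1 := RootLeafO.prob_T' p hf hleaf h1u h12 h1c
  have e2 := RootLeafO.prob_T p hf hleaf h1u h12 h1c
  unfold EQ3
  rw [e1, e2]
  ring

omit [LinearOrder R] [IsStrictOrderedRing R] in
include h1o in
/-- `EQ3o = q·EQ3o¹ − (1 − q)·P(a₂ ↔ c, a₂ ↔ o)`. -/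
lemma split_EQ3o : EQ3o p ends o a₁ a₂ c =
    p f * EQ3o p ends o u a₂ c - (1 - p f) * prob p (connEvent ends a₂ c ∩ connEvent ends a₂ o) := by
  have fo : Free f (connEvent ends a₂ o) := free_connEvent hf hleaf h1u (Ne.symm h12) (Ne.symm h1o)
  have e1 := RootLeafO.prob_T'_inter_L₀ p hf hleaf h1u h12 h1c (Ne.symm h1o)
  have e2 := RootLeafO.prob_T'_inter p hf hleaf h1u h12 h1c fo
  have e3 := RootLeafO.prob_T_inter_L₀ p hf hleaf h1u h12 h1c (Ne.symm h1o)
  have e4 := RootLeafO.prob_T_inter p hf hleaf h1u h12 h1c fo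
  unfold EQ3o
  rw [e1, e2, e3, e4]
  ring

omit [LinearOrder R] [IsStrictOrderedRing R] in
include h1b in
/-- `EQb3 = q·EQb3¹ + (1 − q)·P(a₂ ↔ c, a₂ ↔ b)`. -/
lemma split_EQb3 : EQb3 p ends a₁ a₂ c b =
    p f * EQb3 p ends u a₂ c b + (1 - p f) * prob p (connEvent ends a₂ c ∩ connEvent ends a₂ b) := by
  have fb : Free f (connEvent ends a₂ b) := free_connEvent hf hleaf h1u (Ne.symm h12) (Ne.symm h1b)
  have e1 := RootLeafO.prob_T'_inter_L₀ p hf hleaf h1u h12 h1c (Ne.symm h1b)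
  have e2 := RootLeafO.prob_T_inter p hf hleaf h1u h12 h1c fb
  have e3 := RootLeafO.prob_T_inter_L₀ p hf hleaf h1u h12 h1c (Ne.symm h1b)
  have e4 := RootLeafO.prob_T'_inter p hf hleaf h1u h12 h1c fb
  unfold EQb3
  rw [e1, e2, e3, e4]
  ring

omit [LinearOrder R] [IsStrictOrderedRing R] in
include h1o h1b in
/-- `EQb3o = q·EQb3o¹ + (1 − q)·P(a₂ ↔ c, a₂ ↔ o, a₂ ↔ b)`. -/
lemma split_EQb3o : EQb3o p ends o a₁ a₂ c b =
    p f * EQb3o p ends o u a₂ c b +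
      (1 - p f) * prob p (connEvent ends a₂ c ∩ (connEvent ends a₂ o ∩ connEvent ends a₂ b)) := by
  have fo : Free f (connEvent ends a₂ o) := free_connEvent hf hleaf h1u (Ne.symm h12) (Ne.symm h1o)
  have fb : Free f (connEvent ends a₂ b) := free_connEvent hf hleaf h1u (Ne.symm h12) (Ne.symm h1b)
  have e1 := RootLeafO.prob_T'_inter_LL p hf hleaf h1u h12 h1c (Ne.symm h1o) (Ne.symm h1b)
  have e2 := RootLeafO.prob_T'_inter_R p hf hleaf h1u h12 h1c (Ne.symm h1b) fo
  have e3 := RootLeafO.prob_T_inter_L p hf hleaf h1u h12 h1c (Ne.symm h1o) fb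
  have e4 := RootLeafO.prob_T_inter p hf hleaf h1u h12 h1c (fo.inter fb)
  have e5 := RootLeafO.prob_T_inter_LL p hf hleaf h1u h12 h1c (Ne.symm h1o) (Ne.symm h1b)
  have e6 := RootLeafO.prob_T_inter_R p hf hleaf h1u h12 h1c (Ne.symm h1b) fo
  have e7 := RootLeafO.prob_T'_inter_L p hf hleaf h1u h12 h1c (Ne.symm h1o) fb
  have e8 := RootLeafO.prob_T'_inter p hf hleaf h1u h12 h1c (fo.inter fb)
  unfold EQb3o
  rw [e1, e2, e3, e4, e5, e6, e7, e8]
  ring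

end Splits

end RootLeafU

end Summit.Ventures.PercRepro2
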